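import Literature.Probability.LatticeModels.RandomClusterFKG
import HarnessLib

/-!
# Successive conditioning for the random-cluster measure over disjoint regions, proved

Topic `Literature/Probability/LatticeModels` (trunk `StatMech`). The bookkeeping half of the
"successive conditionings" of Duminil-Copin–Smirnov (Clay Math. Proc. 15 (2012), §6.1, proof of
Thm. 6.1, eqs. (6.1)–(6.2): "for some constant `c < 1` uniform in … the configuration outside of
`S_{r,2r}(x)`" and "decompose the annulus `S_{r,R}(x)` into roughly `ln₂(R/r)` annuli") for the
finite-graph random-cluster measure `φ = rcMeasure G p q B` of the tree: conditional bounds that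
hold *uniformly in the configuration off a region* multiply over pairwise disjoint regions.

* `rcMeasure_real_inter_eq_sum_cylinder` — decomposition along the cylinders of a region `U`:
  if the event `F` is determined by the configuration off `U`, then
  `φ(A ∩ F) = ∑_{ξ ⊆ E ∖ U, ξ ∈ F} φ(A ∩ {ω ∖ U = ξ})`.
* `rcMeasure_real_inter_le_mul_of_cylinder_le` — if `φ(A ∩ {ω ∖ U = ξ}) ≤ θ φ({ω ∖ U = ξ})` for
  every configuration `ξ` off `U` ("the bound holds uniformly in the configuration outside"),
  then `φ(A ∩ F) ≤ θ φ(F)` for every event `F` determined off `U`.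
* `rcMeasure_real_biInter_le_prod` — for pairwise disjoint regions `U_i`, events `E_i`
  determined by the configuration on `U_i`, and constants `θ_i ≥ 0` bounding `E_i` uniformly in
  the configuration off `U_i`, `φ(⋂_i E_i) ≤ ∏_i θ_i` (induction on the number of regions; DCS's
  `φ(A_{2k}(x; r, R)) ≤ (c^k)^{⌊log₂(R/r)⌋}` is the case of the dyadic annuli).

The uniform conditional bounds themselves are supplied, for increasing `E_i`, by
`rcMeasure_real_inter_cylinder_le_mul_fromEdgeSet` (`RandomClusterConditionalDomination.lean`)
together with a bound under the wired measure of the region. Everything is proved; no definitions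
(determinacy of an event by the configuration on/off a region is written out as a hypothesis).

## References

* H. Duminil-Copin, S. Smirnov, *Conformal invariance of lattice models*, Clay Math. Proc. 15
  (2012) 213–276 (arXiv:1109.1549): §6.1, proof of Thm. 6.1, (6.1)–(6.2), p. 27.
* G. Grimmett, *The Random-Cluster Model*, Springer (2006): §4.2, Lemma (4.13) (nesting).
-/

noncomputable section

open MeasureTheory Finset SimpleGraph

namespace Literature.Probability.LatticeModels

section SetLemmas

variable {V : Type*} [DecidableEq V]

/-- The part off `U` of a lattice configuration `ω` is the lattice configuration `ω ∖ U`: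
`↑ω ∩ (↑U)ᶜ = ↑(ω ∖ U)`. [folklore] -/
theorem coe_inter_compl_eq_coe_sdiff (ω U : Finset (Sym2 V)) :
    (↑ω : Set (Sym2 V)) ∩ (↑U)ᶜ = ↑(ω \ U) := by
  rw [Finset.coe_sdiff, Set.sdiff_eq]

omit [DecidableEq V] in
/-- An event determined by the configuration on a region `U'` disjoint from `U` is determined by
the configuration off `U`. [folklore] -/
theorem determined_off_of_determined_on_disjoint {U U' : Finset (Sym2 V)} (hUU' : Disjoint U' U)
    {E : Set (Percolation.BondConfig V)}
    (hE : ∀ ω₁ ω₂ : Percolation.BondConfig V, ω₁ ∩ ↑U' = ω₂ ∩ ↑U' → (ω₁ ∈ E ↔ ω₂ ∈ E))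
    (ω₁ ω₂ : Percolation.BondConfig V) (h : ω₁ ∩ (↑U)ᶜ = ω₂ ∩ (↑U)ᶜ) : ω₁ ∈ E ↔ ω₂ ∈ E := by
  refine hE ω₁ ω₂ ?_
  have hsub : (↑U' : Set (Sym2 V)) ⊆ (↑U)ᶜ := fun e he heU ↦
    Finset.disjoint_left.1 hUU' (Finset.mem_coe.1 he) (Finset.mem_coe.1 heU)
  have h1 : ω₁ ∩ ↑U' = (ω₁ ∩ (↑U)ᶜ) ∩ ↑U' := by
    rw [Set.inter_assoc, Set.inter_eq_right.2 hsub]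
  have h2 : ω₂ ∩ ↑U' = (ω₂ ∩ (↑U)ᶜ) ∩ ↑U' := by
    rw [Set.inter_assoc, Set.inter_eq_right.2 hsub]
  rw [h1, h2, h]

end SetLemmas

section Finite

variable {V : Type*} [Fintype V] [DecidableEq V] (G : SimpleGraph V) [DecidableRel G.Adj]

/-- **Decomposition of an event determined off a region along the cylinders of the region.** Let
`U ⊆ E(G)` and let `F` be determined by the configuration off `U` (if `ω₁ ∖ U = ω₂ ∖ U` then
`ω₁ ∈ F ↔ ω₂ ∈ F`). Then for every event `A`,
`φ(A ∩ F) = ∑_{ξ ⊆ E(G) ∖ U, ξ ∈ F} φ(A ∩ {ω | ω ∖ U = ξ})` (the cylinders `{ω ∖ U = ξ}` with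
`ξ ∈ F` partition `F` up to a null set). (Grimmett 2006, §4.2: conditioning on `T_Λ`.)
[cite: Grimmett2006, §4.2, Lemma (4.13)] -/
theorem rcMeasure_real_inter_eq_sum_cylinder {p q : ℝ} (hp : p ∈ Set.Icc (0 : ℝ) 1) (hq : 0 < q)
    (B : Set V) (U : Finset (Sym2 V)) (A F : Set (Percolation.BondConfig V))
    (hF : ∀ ω₁ ω₂ : Percolation.BondConfig V, ω₁ ∩ (↑U)ᶜ = ω₂ ∩ (↑U)ᶜ → (ω₁ ∈ F ↔ ω₂ ∈ F))
    [DecidablePred (· ∈ F)] :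
    (rcMeasure G p q B).real (A ∩ F) =
      ∑ ξ ∈ (G.edgeFinset \ U).powerset.filter
          (fun ξ : Finset (Sym2 V) ↦ (↑ξ : Percolation.BondConfig V) ∈ F),
        (rcMeasure G p q B).real (A ∩ {ω | ω ∩ (↑U : Set (Sym2 V))ᶜ = ↑ξ}) := by
  classical
  set w : Finset (Sym2 V) → ℝ := fun ω ↦ rcWeight G p q B ω / rcPartitionFunction G p q B with hw
  -- both sides as sums over the edge sets of `G`
  have hL : (rcMeasure G p q B).real (A ∩ F) =
      ∑ ω ∈ G.edgeFinset.powerset, if (↑ω : Percolation.BondConfig V) ∈ A ∩ F then w ω else 0 :=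
    rcMeasure_real_apply G hp hq B (A ∩ F)
  have hR : ∀ ξ : Finset (Sym2 V),
      (rcMeasure G p q B).real (A ∩ {ω | ω ∩ (↑U : Set (Sym2 V))ᶜ = ↑ξ}) =
        ∑ ω ∈ G.edgeFinset.powerset,
          if (↑ω : Percolation.BondConfig V) ∈ A ∩ {ω | ω ∩ (↑U : Set (Sym2 V))ᶜ = ↑ξ} then w ω
          else 0 :=
    fun ξ ↦ rcMeasure_real_apply G hp hq B _
  rw [hL]
  simp_rw [hR]
  rw [Finset.sum_comm]
  refine Finset.sum_congr rfl fun ω hω ↦ ?_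
  rw [Finset.mem_powerset] at hω
  -- for fixed `ω`, only the cylinder of `ξ = ω ∖ U` contributes
  have hωU : (↑ω : Set (Sym2 V)) ∩ (↑U)ᶜ = ↑(ω \ U) := coe_inter_compl_eq_coe_sdiff ω U
  have hFω : ((↑(ω \ U) : Percolation.BondConfig V) ∈ F) ↔ ((↑ω : Percolation.BondConfig V) ∈ F) := by
    refine hF _ _ ?_
    rw [← hωU, Set.inter_assoc, Set.inter_self]
  rw [Finset.sum_filter]
  have hterm : ∀ ξ ∈ (G.edgeFinset \ U).powerset,
      (if (↑ξ : Percolation.BondConfig V) ∈ F then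
        (if (↑ω : Percolation.BondConfig V) ∈ A ∩ {ω | ω ∩ (↑U : Set (Sym2 V))ᶜ = ↑ξ} then w ω else 0)
        else 0) =
      if ξ = ω \ U then (if (↑ω : Percolation.BondConfig V) ∈ A ∩ F then w ω else 0) else 0 := by
    intro ξ _
    by_cases hξ : ξ = ω \ U
    · subst hξ
      rw [if_pos rfl]
      by_cases hωF : (↑ω : Percolation.BondConfig V) ∈ F
      · rw [if_pos (hFω.2 hωF)]
        by_cases hωA : (↑ω : Percolation.BondConfig V) ∈ A
        · rw [if_pos ⟨hωA, hωU⟩, if_pos ⟨hωA, hωF⟩]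
        · rw [if_neg (fun h ↦ hωA h.1), if_neg (fun h ↦ hωA h.1)]
      · rw [if_neg (fun h ↦ hωF (hFω.1 h)), if_neg (fun h ↦ hωF h.2)]
    · rw [if_neg hξ]
      have hC : (↑ω : Percolation.BondConfig V) ∉ A ∩ {ω | ω ∩ (↑U : Set (Sym2 V))ᶜ = ↑ξ} := by
        rintro ⟨-, h⟩
        refine hξ (Finset.coe_injective ?_)
        rw [← h]
        exact hωU
      rw [if_neg hC, ite_self]
  rw [Finset.sum_congr rfl hterm, Finset.sum_ite_eq']
  exact (if_pos (Finset.mem_powerset.2 (Finset.sdiff_subset_sdiff hω le_rfl))).symm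

/-- **A bound uniform in the configuration off a region passes to every event determined off the
region** (the elementary step of DCS's "successive conditionings", 2012, p. 27): if for every
configuration `ξ ⊆ E(G) ∖ U` off the region `U`, `φ(A ∩ {ω ∖ U = ξ}) ≤ θ · φ({ω ∖ U = ξ})`, then
`φ(A ∩ F) ≤ θ · φ(F)` for every event `F` determined by the configuration off `U`.
[cite: DuminilCopinSmirnov2012Clay, §6.1, proof of Thm. 6.1] -/
theorem rcMeasure_real_inter_le_mul_of_cylinder_le {p q : ℝ} (hp : p ∈ Set.Icc (0 : ℝ) 1)
    (hq : 0 < q) (B : Set V) (U : Finset (Sym2 V)) {A F : Set (Percolation.BondConfig V)}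
    (hF : ∀ ω₁ ω₂ : Percolation.BondConfig V, ω₁ ∩ (↑U)ᶜ = ω₂ ∩ (↑U)ᶜ → (ω₁ ∈ F ↔ ω₂ ∈ F))
    {θ : ℝ}
    (hθ : ∀ ξ : Finset (Sym2 V), ξ ⊆ G.edgeFinset \ U →
      (rcMeasure G p q B).real (A ∩ {ω | ω ∩ (↑U : Set (Sym2 V))ᶜ = ↑ξ}) ≤
        θ * (rcMeasure G p q B).real {ω | ω ∩ (↑U : Set (Sym2 V))ᶜ = ↑ξ}) :
    (rcMeasure G p q B).real (A ∩ F) ≤ θ * (rcMeasure G p q B).real F := by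
  classical
  have hF' : (rcMeasure G p q B).real F = (rcMeasure G p q B).real (Set.univ ∩ F) := by
    rw [Set.univ_inter]
  rw [rcMeasure_real_inter_eq_sum_cylinder G hp hq B U A F hF, hF',
    rcMeasure_real_inter_eq_sum_cylinder G hp hq B U Set.univ F hF, Finset.mul_sum]
  refine Finset.sum_le_sum fun ξ hξ ↦ ?_
  rw [Finset.mem_filter, Finset.mem_powerset] at hξ
  rw [Set.univ_inter]
  exact hθ ξ hξ.1

/-- **Successive conditioning over disjoint regions** (Duminil-Copin–Smirnov 2012, §6.1, proof of
Thm. 6.1: the bound `c^k` for one annulus holds "uniformly in the configuration outside", and the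
`⌊log₂(R/r)⌋` dyadic annuli then give `(c^k)^{⌊log₂(R/r)⌋}`, eq. (6.2)). Let `U_i`, `i ∈ s`, be
pairwise disjoint sets of edges of `G`, `E_i` events determined by the configuration on `U_i`, and
`θ_i ≥ 0` constants such that `φ(E_i ∩ {ω ∖ U_i = ξ}) ≤ θ_i φ({ω ∖ U_i = ξ})` for every
configuration `ξ` off `U_i`. Then `φ(⋂_{i ∈ s} E_i) ≤ ∏_{i ∈ s} θ_i` (`0 ≤ p ≤ 1`, `q > 0`).
[cite: DuminilCopinSmirnov2012Clay, §6.1, proof of Thm. 6.1, eq. (6.2)] -/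
theorem rcMeasure_real_biInter_le_prod {p q : ℝ} (hp : p ∈ Set.Icc (0 : ℝ) 1) (hq : 0 < q)
    (B : Set V) {ι : Type*} (s : Finset ι) (U : ι → Finset (Sym2 V))
    (hdisj : (s : Set ι).Pairwise fun i j ↦ Disjoint (U i) (U j))
    (E : ι → Set (Percolation.BondConfig V))
    (hE : ∀ i ∈ s, ∀ ω₁ ω₂ : Percolation.BondConfig V, ω₁ ∩ ↑(U i) = ω₂ ∩ ↑(U i) → (ω₁ ∈ E i ↔ ω₂ ∈ E i))
    (θ : ι → ℝ) (hθ0 : ∀ i ∈ s, 0 ≤ θ i)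
    (hθ : ∀ i ∈ s, ∀ ξ : Finset (Sym2 V), ξ ⊆ G.edgeFinset \ U i →
      (rcMeasure G p q B).real (E i ∩ {ω | ω ∩ (↑(U i) : Set (Sym2 V))ᶜ = ↑ξ}) ≤
        θ i * (rcMeasure G p q B).real {ω | ω ∩ (↑(U i) : Set (Sym2 V))ᶜ = ↑ξ}) :
    (rcMeasure G p q B).real (⋂ i ∈ s, E i) ≤ ∏ i ∈ s, θ i := by
  classical
  haveI := isProbabilityMeasure_rcMeasure G hp hq B
  induction s using Finset.induction_on with
  | empty => simp
  | insert a s ha ih =>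
    have hdisj' : ((s : Set ι)).Pairwise fun i j ↦ Disjoint (U i) (U j) :=
      hdisj.mono (by simp)
    have ih' := ih hdisj' (fun i hi ↦ hE i (Finset.mem_insert_of_mem hi))
      (fun i hi ↦ hθ0 i (Finset.mem_insert_of_mem hi)) (fun i hi ↦ hθ i (Finset.mem_insert_of_mem hi))
    rw [Finset.set_biInter_insert, Finset.prod_insert ha]
    -- `⋂_{i ∈ s} E_i` is determined off `U a`
    have hF : ∀ ω₁ ω₂ : Percolation.BondConfig V, ω₁ ∩ (↑(U a))ᶜ = ω₂ ∩ (↑(U a))ᶜ →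
        (ω₁ ∈ ⋂ i ∈ s, E i ↔ ω₂ ∈ ⋂ i ∈ s, E i) := by
      intro ω₁ ω₂ h
      simp only [Set.mem_iInter]
      refine forall₂_congr fun i hi ↦ ?_
      have hai : a ≠ i := fun h' ↦ ha (h' ▸ hi)
      exact determined_off_of_determined_on_disjoint
        ((hdisj (Finset.mem_insert_of_mem hi) (Finset.mem_insert_self a s) hai.symm))
        (hE i (Finset.mem_insert_of_mem hi)) ω₁ ω₂ h
    calc (rcMeasure G p q B).real (E a ∩ ⋂ i ∈ s, E i)
        ≤ θ a * (rcMeasure G p q B).real (⋂ i ∈ s, E i) :=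
          rcMeasure_real_inter_le_mul_of_cylinder_le G hp hq B (U a) hF
            (hθ a (Finset.mem_insert_self a s))
      _ ≤ θ a * ∏ i ∈ s, θ i :=
          mul_le_mul_of_nonneg_left ih' (hθ0 a (Finset.mem_insert_self a s))

end Finite

end Literature.Probability.LatticeModels

end
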